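import Mathlib
import Summits.RiemannHypothesis.RiemannHypothesis.Theses.WeilGroundState
import Summits.RiemannHypothesis.RiemannHypothesis.Theorems.WeilGroundStateGroundStateSimpleEvenOfOddSectorGap
import Summits.RiemannHypothesis.RiemannHypothesis.Theorems.WeilGroundStateGroundStateSimpleEvenFirstPrimeWindows
import Summits.RiemannHypothesis.RiemannHypothesis.Theorems.WeilParityEvenWinsBeyondArchSplit
import Summits.RiemannHypothesis.RiemannHypothesis.Theorems.WeilParityOnePrimeWindowSimpleEven
import HarnessLib

/-!
# `GroundStateSimpleEven` ↔ `NoParityCrossing`: the crux of route WeilGroundState IS the residue item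
of route WeilParity (crux stmt-RiemannHypothesis-1526, line `parity-multiplicity-commutator`, lead c4;
`--supports`: calibration for the planners of both routes, RH-free)

After cycles 1–3 of the line the crux `GroundStateSimpleEven` (`∀ a > 0, WeilWindowSimpleEven a`: the
Connes–van Suijlekom hypothesis at every window) is PROVED on every window `0 < a ≤ (log 3)/2`
(`Theorems.weilWindowSimpleEven_of_le_log_three_half`) and kernel-checked equivalent to its odd branch
(`GroundStateSimpleEven.groundStateSimpleEven_iff_oddSectorGap`); its single open stub is ORDER beyond the
second prime, `stub_oddSectorGap_beyond`.  The sister route WeilParity files exactly this residue as an ITEM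
in parity-symmetric form — `NoParityCrossing` (stmt-RiemannHypothesis-18085): for `a > (log 3)/2` the two
sector bottoms `ε_ev(a)`, `ε_od(a)` never coincide — and has landed the RH-free glue around it (sector
continuity `stub_sectorContinuity`, IVT propagation, `EvenWinsBeyondArch.forall_weilWindowSimpleEven_iff_subs`,
and `OnePrimeWindowSimpleEven` CLOSED from this line's certified cells).  This file records the resulting
calibration, kernel-checked:

* `oddSectorGap_iff_weilEvenGroundEnergy_lt` — at a window `a > 0`, ORDER(a) ↔ `ε_ev(a) < ε_od(a)`;
* `oddSectorGapBeyond_iff_noParityCrossing` — the open stub of the skeleton (ORDER for every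
  `a > (log 3)/2`) is EQUIVALENT to `NoParityCrossing`;
* `groundStateSimpleEven_iff_noParityCrossing` — **the crux itself is equivalent to `NoParityCrossing`**;
  `groundStateSimpleEven_of_noParityCrossing` is the direction the skeleton v6 composes.

So items stmt-RiemannHypothesis-1526 and stmt-RiemannHypothesis-18085 are ONE statement up to landed
RH-free theorems; whichever closes (or is refuted) settles the other by the maps below.  No new definitions.
-/

-- single-conjunct summit: the mandated namespace repeats a component (D-0017)
set_option linter.dupNamespace false

noncomputable section

namespace Summit.RiemannHypothesis.RiemannHypothesis.Theorems.GroundStateSimpleEven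

open MeasureTheory Set Filter
open scoped Real Topology ComplexConjugate
open Literature.NumberTheory.LFunctions
open Summit.RiemannHypothesis.RiemannHypothesis.Theses.WeilGroundState
open Summit.RiemannHypothesis.RiemannHypothesis.Theses.WeilParity
open Summit.RiemannHypothesis.RiemannHypothesis.Theorems.EvenWinsBeyondArch

/-! ## ORDER at one window in ground-energy language -/

/-- **ORDER(a) ↔ `ε_ev(a) < ε_od(a)`** at a window `a > 0`: an odd-sector gap above the bottom `ε(a)` is the
same as the strict order of the two sector bottoms (both directions are compositions of landed theorems:
`→` via the halving theorem `weilWindowSimpleEven_of_oddSectorGap` and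
`weilEvenGroundEnergy_lt_weilOddGroundEnergy_of_weilWindowSimpleEven`; `←` is
`oddSectorGap_of_weilEvenGroundEnergy_lt`). [folklore] -/
theorem oddSectorGap_iff_weilEvenGroundEnergy_lt {a : ℝ} (ha : 0 < a) :
    (∃ δ : ℝ, 0 < δ ∧ ∀ g : ℝ → ℂ, IsWeilTest g → tsupport g ⊆ Icc (-a) a →
      ∫ t, ‖g t‖ ^ 2 = (1 : ℝ) → (∀ t, g (-t) = -g t) →
        weilGroundEnergy a + δ ≤ (weilQuadratic g).re) ↔
      weilEvenGroundEnergy a < weilOddGroundEnergy a :=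
  ⟨fun h ↦ weilEvenGroundEnergy_lt_weilOddGroundEnergy_of_weilWindowSimpleEven ha
      (weilWindowSimpleEven_of_oddSectorGap ha h),
    oddSectorGap_of_weilEvenGroundEnergy_lt⟩

/-! ## The crux from `NoParityCrossing`, window-wise -/

/-- **`NoParityCrossing` gives the Connes–van Suijlekom clause at EVERY window `a > 0`**: up to the second
prime it is proved outright (`weilWindowSimpleEven_of_le_log_three_half`), beyond it the closed item
`OnePrimeWindowSimpleEven` and `NoParityCrossing` give it by IVT propagation
(`forall_weilWindowSimpleEven_iff_subs`). [folklore] -/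
theorem weilWindowSimpleEven_of_noParityCrossing (h : NoParityCrossing) {a : ℝ} (ha : 0 < a) :
    WeilWindowSimpleEven a := by
  rcases le_or_gt a (Real.log 3 / 2) with hle | hlt
  · exact Summit.RiemannHypothesis.RiemannHypothesis.Theorems.weilWindowSimpleEven_of_le_log_three_half
      a ha hle
  · exact forall_weilWindowSimpleEven_iff_subs.2
      ⟨Summit.RiemannHypothesis.RiemannHypothesis.Theorems.WeilParity.onePrimeWindowSimpleEven_proof, h⟩
      a (log_two_half_lt_log_three_half.trans hlt)

/-- **`NoParityCrossing → GroundStateSimpleEven`** (the direction composed by the skeleton v6 of line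
`parity-multiplicity-commutator`; conclusion = the route decl by name). [folklore] -/
theorem groundStateSimpleEven_of_noParityCrossing (h : NoParityCrossing) : GroundStateSimpleEven :=
  fun _ ha ↦ weilWindowSimpleEven_of_noParityCrossing h ha

/-- **`GroundStateSimpleEven → NoParityCrossing`**: at `a > (log 3)/2` the clause forces the strict order
`ε_ev(a) < ε_od(a)`, in particular no tie. [folklore] -/
theorem noParityCrossing_of_groundStateSimpleEven (h : GroundStateSimpleEven) : NoParityCrossing :=
  fun a ha ↦
    (weilEvenGroundEnergy_lt_weilOddGroundEnergy_of_weilWindowSimpleEven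
      ((log_two_half_pos.trans log_two_half_lt_log_three_half).trans ha)
      (h a ((log_two_half_pos.trans log_two_half_lt_log_three_half).trans ha))).ne

/-- **CALIBRATION: the crux of route WeilGroundState is equivalent to the residue item of route
WeilParity** — `GroundStateSimpleEven ↔ NoParityCrossing` (stmt-RiemannHypothesis-1526 ↔
stmt-RiemannHypothesis-18085), RH-free. [folklore] -/
theorem groundStateSimpleEven_iff_noParityCrossing : GroundStateSimpleEven ↔ NoParityCrossing :=
  ⟨noParityCrossing_of_groundStateSimpleEven, groundStateSimpleEven_of_noParityCrossing⟩

/-! ## The open stub of the skeleton is `NoParityCrossing` -/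

/-- **ORDER beyond the second prime from `NoParityCrossing`** (the skeleton's residue
`stub_oddSectorGap_beyond` discharged from item 18085). [folklore] -/
theorem oddSectorGapBeyond_of_noParityCrossing (h : NoParityCrossing) :
    ∀ a : ℝ, Real.log 3 / 2 < a → ∃ δ : ℝ, 0 < δ ∧ ∀ g : ℝ → ℂ, IsWeilTest g →
      tsupport g ⊆ Icc (-a) a → ∫ t, ‖g t‖ ^ 2 = (1 : ℝ) → (∀ t, g (-t) = -g t) →
        weilGroundEnergy a + δ ≤ (weilQuadratic g).re := by
  intro a ha
  have ha0 : 0 < a := (log_two_half_pos.trans log_two_half_lt_log_three_half).trans ha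
  exact (weilWindowSimpleEven_iff_oddSectorGap ha0).1 (weilWindowSimpleEven_of_noParityCrossing h ha0)

/-- **The residue of the line IS item 18085**: ORDER for every `a > (log 3)/2` ↔ `NoParityCrossing`.
[folklore] -/
theorem oddSectorGapBeyond_iff_noParityCrossing :
    (∀ a : ℝ, Real.log 3 / 2 < a → ∃ δ : ℝ, 0 < δ ∧ ∀ g : ℝ → ℂ, IsWeilTest g →
      tsupport g ⊆ Icc (-a) a → ∫ t, ‖g t‖ ^ 2 = (1 : ℝ) → (∀ t, g (-t) = -g t) →
        weilGroundEnergy a + δ ≤ (weilQuadratic g).re) ↔ NoParityCrossing := by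
  refine ⟨fun h a ha ↦ ?_, oddSectorGapBeyond_of_noParityCrossing⟩
  have ha0 : 0 < a := (log_two_half_pos.trans log_two_half_lt_log_three_half).trans ha
  exact ((oddSectorGap_iff_weilEvenGroundEnergy_lt ha0).1 (h a ha)).ne

/-- **Every ground state at every window is a.e. even ↔ `NoParityCrossing`** ("evenness decides",
`groundStateSimpleEven_iff_groundStates_ae_even`, composed with the calibration). [folklore] -/
theorem groundStates_ae_even_iff_noParityCrossing :
    (∀ a : ℝ, 0 < a → ∀ u : ℝ → ℂ, IsWeilGroundState a u → u =ᵐ[volume] fun t ↦ u (-t)) ↔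
      NoParityCrossing :=
  groundStateSimpleEven_iff_groundStates_ae_even.symm.trans groundStateSimpleEven_iff_noParityCrossing

end Summit.RiemannHypothesis.RiemannHypothesis.Theorems.GroundStateSimpleEven

namespace Summit.RiemannHypothesis.RiemannHypothesis.Theorems

open MeasureTheory Set
open Literature.NumberTheory.LFunctions

/-- **Registered stub (BRIDGE) of line `parity-multiplicity-commutator`, skeleton v6**: no parity tie
beyond the second prime (the statement of item stmt-RiemannHypothesis-18085, unfolded) implies ORDER at
every window `a > (log 3)/2` — the v5 residue `stub_oddSectorGap_beyond` — by IVT propagation from the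
certified anchor and the landed sector continuity
(`GroundStateSimpleEven.oddSectorGapBeyond_of_noParityCrossing`). [folklore] -/
theorem stub_oddSectorGapBeyond_of_noParityCrossing :
    (∀ a : ℝ, Real.log 3 / 2 < a → weilEvenGroundEnergy a ≠ weilOddGroundEnergy a) →
    ∀ a : ℝ, Real.log 3 / 2 < a → ∃ δ : ℝ, 0 < δ ∧ ∀ g : ℝ → ℂ, IsWeilTest g →
      tsupport g ⊆ Icc (-a) a → ∫ t, ‖g t‖ ^ 2 = (1 : ℝ) → (∀ t, g (-t) = -g t) →
        weilGroundEnergy a + δ ≤ (weilQuadratic g).re :=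
  GroundStateSimpleEven.oddSectorGapBeyond_of_noParityCrossing

end Summit.RiemannHypothesis.RiemannHypothesis.Theorems

end
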